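import Literature.NumberTheory.ComplexMultiplication.ReflexNormIdelesTransitivity
import HarnessLib

/-!
# The reflex norm decomposed over the orbits of `Gal(Q̄/k)` on `Φ`: `N_Φ(a) = ∏_j Nm_{L_j/E}(σ_j⁻¹ a)` on `R`-points,
# adèles and idèles (Milne, *The fundamental theorem of complex multiplication*, arXiv:0705.3446, §4.2, proof of Prop. 4.9;
# *Complex Multiplication* Ch. I §1 Prop. 1.21 / Prop. 1.26)

Topic `NumberTheory/ComplexMultiplication`; namespace `Literature.NumberTheory.ComplexMultiplication`.  Lane
`lit-hodgefound` (Track 2, Layer A3 skeleton seat `skel-3`, row A3-G46 FILE 2 of 4: the IDELIC half «`N_Φ(a) = ∏ b_j`,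
`b_j = Nm_{L_j/E}(σ_j⁻¹(a))`» of Milne's proof of Proposition 4.9; FILE 1 `…/TateHalfTransferOrbits` is the group theory
«`F_j(σ) = σ_j⁻¹V(σ)σ_j`», FILE 3 `…/TateHalfTransferReflexNorm` joins the two through the Artin maps, FILE 4
`…/TaniyamaElementReflexNorm` is Proposition 4.9).  One reducible non-instance definition (`orbitFieldAlgebra`, the
`K`-algebra structure `K → k·φ(K)` through `φ`, made a LOCAL instance) and theorems, all proved; no named fact, no global
instance (D-0026, net debt 0).

## The print, verbatim

J. S. Milne, *The fundamental theorem of complex multiplication*, arXiv:0705.3446 [Milne2007FundamentalCM], §4.2 (held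
`paper:arxiv-0705.3446` p0020 L38–L80):

> «Let `E*` be the reflex field for `(E,Φ)`, so that `Aut(ℂ/E*) = {σ ∈ Aut(ℂ) | σΦ = Φ}`. Then
> `Φ Aut(ℂ/E) = ⋃_{φ∈Φ} φ·Aut(ℂ/E)` is stable under the left action of `Aut(ℂ/E*)`, and we write
> `Aut(ℂ/E)Φ⁻¹ = ⋃ ψ·Aut(ℂ/E*)` (disjoint union). The set `Ψ = {ψ|E*}` is a CM-type for `E*`, and `(E*,Ψ)` is the reflex
> of `(E,Φ)`. The map `a ↦ ∏_{ψ∈Ψ} ψ(a) : E* → ℂ` factors through `E` and defines a morphism of algebraic tori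
> `N_Φ : T^{E*} → T^E`. […] PROOF [of Prop. 4.9]. Partition `Φ` into orbits, `Φ = ∪_j Φ_j`, for the left action of
> `Aut(ℂ/E*)`. Then `Aut(ℂ/E)Φ⁻¹ = ⋃_j Aut(ℂ/E)Φ_j⁻¹`, and
> `Aut(ℂ/E)Φ_j⁻¹ = Aut(ℂ/E)(σ_j⁻¹Aut(ℂ/E*)) = (Hom_E(L_j,ℂ) ∘ σ_j⁻¹)Aut(ℂ/E*)` where `σ_j` is any element of `Aut(ℂ)` such
> that `σ_j|E ∈ Φ_j` and `L_j = (σ_j⁻¹E*)E`. Thus `N_Φ(a) = ∏ b_j`, with `b_j = Nm_{L_j/E}(σ_j⁻¹(a))`.»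

J. S. Milne, *Complex Multiplication* (course notes, 2020 text `paper:url-8ccc30e4daab` pp. 15–17) [MilneCM2006], Ch. I
§1 Prop. 1.21 (the `E ⊗_ℚ k`-module `V_Φ`, in the tree `⊕_O k·φ_O(E)` over the `Aut(ℂ/k)`-orbits `O ⊆ Φ`), the reflex
norm «`N_{k,Φ}(a) = det_{E⊗_ℚ R}(a | V_Φ ⊗_ℚ R)` … functorial in `R`», Rem. 1.25 («From these maps, we get a continuous
homomorphism on the groups of idèles `𝔸_k^× → 𝔸_E^×`») and Prop. 1.26 («`det_E(a : k_φ → k_φ) = φ⁻¹(Nm_{k/φE} a)`»).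

## Reading (the tree's vocabulary)

`E = K : Type` a number field, `Φ : Motives.CMType K`, `k : IntermediateField ℚ ℂ` a number field containing
`E* = traceField Φ` where needed (Milne's statement is `k = E*`; for the Main Theorem over a field of definition
`k ⊇ E*` one needs every such `k`, and the orbit decomposition is the same with `Aut(ℂ/E*)` replaced by `Aut(ℂ/k)`).
The `Aut(ℂ/k)`-orbits `O ⊆ Φ` are indexed by p27's chosen representatives `r ∈ orbitReps (cmTypeEquivCMTypeOn K Φ) k`
(`…/CMTypeTraceModule`; `r : K →ₐ[ℚ] ℂ`, `r ∈ Φ`), Milne's `σ_j|E`.  For such `r` the field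
`M_r = orbitField k r = k·r(K) ⊂ ℂ` is Milne's `σ_jL_j = E*·σ_j(E)`; it is a `k`-algebra by inclusion and a `K`-ALGEBRA
THROUGH `r` (`orbitFieldAlgebra`, the tree's `toOrbitField k r : K → k·r(K)`), so that
`Nm_{M_r/K} = Nm_{L_j/E} ∘ σ_j⁻¹` on elements, adèles and idèles: the isomorphism `σ_j : L_j ≅ σ_jL_j` of Milne's proof,
which carries `E ⊆ L_j` to `σ_j(E) ⊆ σ_jL_j`, is absorbed into the choice of the `K`-algebra structure on `M_r`, and
«`σ_j⁻¹(a)` for `a ∈ 𝔸_{E*}`» becomes the conorm `con_{M_r/k} a` (`NumberField.AdeleRing.baseChange k M_r`).  With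
this reading Milne's «`N_Φ(a) = ∏_j b_j`, `b_j = Nm_{L_j/E}(σ_j⁻¹(a))`» is
`N_{k,Φ}(a) = ∏_r Nm_{M_r/K}(con_{M_r/k} a)`.

## What is proved

* §0 `orbitFieldAlgebra K k φ : Algebra K (orbitField k φ)` (through `φ`; reducible, a LOCAL instance in this file — as
  Mathlib's `Algebra.TensorProduct.rightAlgebra` / the packet's `tensorTowerAlgebra`), `IsScalarTower ℚ K (k·φ(K))`,
  `Module.Finite K (k·φ(K))`, `NumberField (k·φ(K))` (`isScalarTower_orbitField`, `moduleFinite_orbitField`,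
  `numberField_orbitField`; local instances), and the inclusion `toOrbitFieldBase k φ : k →ₐ[ℚ] k·φ(K)`.
* §1 **ON `R`-POINTS** (`reflexNormPoints_eq_prod_normPoints_orbitField`): for every commutative `ℚ`-algebra `R` and
  `x ∈ R ⊗_ℚ k`, **`N_{k,Φ}(R)(x) = ∏_r Nm_{M_r⊗R/K⊗R}((1 ⊗ ι_r) x)`** with flt-inv's `normPoints K M_r R` (the norm of the
  restriction-of-scalars tori `T^{M_r} → T^K` on `R`-points, `…/ReflexNormPointsTransitivity`).  PROOF: both sides are
  natural in `R` (`reflexNormPoints_map`, `normPoints_map`) and agree at `R = ℚ`, where the identity is p27's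
  **`reflexNormFrom_eq_prod_norm_orbitField`: `N_{k,Φ}(a) = ∏_r Nm_{k·r(K)/K}(a)`** (`…/ReflexNormDeterminant`; the
  determinant of `a` on `V_Φ = ⊕_O k·φ_O(K)` block by block — Milne's Prop. 1.26 «`det_E(a : k_φ → k_φ) = φ⁻¹(Nm_{k/φE} a)`»
  = the `ℚ`-points of «`N_Φ(a) = ∏ b_j`»); conclude by flt-inv's density lemma `pointsMap_eq_of_natural_of_eq_base'`
  («a morphism of tori is determined on `ℚ`-points»).
* §2 **ON ADÈLES** (`reflexNormAdele_eq_prod_adeleRelNorm_orbitField`): **`N_{k,Φ}(x) = ∏_r Nm_{M_r/K}(con_{M_r/k} x)`**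
  for `x ∈ 𝔸_k`, with Cassels–Fröhlich's adelic norm `adeleRelNorm K M_r` and conorm `AdeleRing.baseChange k M_r` of the
  packet — §1 at `R = 𝔸_ℚ` read through `𝔸_ℚ ⊗_ℚ k = 𝔸_k` (`reflexNormAdele_apply`), `N_{M/K}(e_M z) = e_K(Nm(𝔸_ℚ)(z))`
  (`adeleRelNorm_ratAdeleTensorEquiv_eq_normPoints`) and `e_M ∘ (1 ⊗ ι) = con_{M/k} ∘ e_k`
  (`algebraMap_comp_adeleRingTensorAlgEquiv` of the packet's `…/AdeleNormTower`).
* §3 **ON IDÈLES** (`reflexNormIdele_eq_prod_ideleRelNorm_orbitField`): the same for `s ∈ 𝕀_k` with the continuous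
  homomorphisms `reflexNormIdele K Φ k`, `ideleRelNorm K M_r` and `Units.map (AdeleRing.baseChange k M_r)` — Milne's
  «`N_Φ(a) = ∏ b_j`» for (finite) idèles is the statement FILE 3 feeds into the Artin map; and on finite parts
  (`finitePart_reflexNormIdele_eq_prod`).

DEVIATIONS.  (i) `k ⊇ E*` any number field in place of `E*` (see above).  (ii) `σ ∈ Γ_ℚ`/`Aut(ℂ)` does not appear here:
the orbits are those of `Aut(ℂ/k)` on `Φ ⊆ Hom(K, ℂ)` as set up by p27; FILE 3 identifies them with the `Γ_k`-orbits on
`Γ_ℚ ⧸ Γ_K`.  (iii) Milne's `b_j` is an element of `𝔸_{f,E}`; here full adèles / idèles (finite parts in §3).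

NOT HERE: the Galois side and the Artin maps (FILE 3); Prop. 4.9 (FILE 4).

## References

* J. S. Milne, *The fundamental theorem of complex multiplication*, arXiv:0705.3446 (2007), §4.2, Prop. 4.9 (proof).
  [Milne2007FundamentalCM]
* J. S. Milne, *Complex Multiplication* (course notes, 2006/2020), Ch. I §1 Prop. 1.21, Rem. 1.25, Prop. 1.26. [MilneCM2006]
* J. W. S. Cassels, A. Fröhlich (eds.), *Algebraic Number Theory* (1967), Ch. II §19 (adelic norm and conorm).
  [CasselsFrohlichANT1967]

## Provenance

Lane `lit-hodgefound`, seat `literature-prover-lit-hodgefound-skel-3-g30-0` (row A3-G46, FILE 2 of 4); consumes BY NAME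
p27's `…/CMTypeTraceModule`, `…/ReflexNormDeterminant`, `…/ReflexNormPoints` and flt-inv's `…/ReflexNormPointsTransitivity`,
`…/ReflexNormIdelesTransitivity`, `…/AdelicBaseChange/AdeleNormTower`.
-/

set_option autoImplicit false

noncomputable section

open scoped TensorProduct NumberField NumberField.AdeleRing IntermediateField

namespace Literature.NumberTheory.ComplexMultiplication

open Literature.AlgebraicGeometry.GaoUllmo2025
open Literature.AlgebraicGeometry.Motives (CMType)
open Literature.NumberTheory.AdelicBaseChange
open Literature.NumberTheory.NumberFields (IdeleAction.finitePart)
open Literature.NumberTheory.GaloisRepresentations (ideleGroup)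
open NumberField IsDedekindDomain Module

/-! ## §0 The fields `M_r = k·r(K)` as `K`-algebras through `r` (Milne's `σ_jL_j ⊇ σ_j(E)`) -/

section OrbitFieldAlgebra

variable (K : Type) [Field K] [NumberField K] (k : IntermediateField ℚ ℂ)

/-- **`K → k·φ(K)` through `φ`**: the `K`-algebra structure on the orbit field `orbitField k φ = k·φ(K) ⊂ ℂ` given by the
tree's `toOrbitField k φ` (Milne's `E ⊆ L_j` transported by `σ_j` to `σ_j(E) ⊆ σ_jL_j`).  A reducible NON-instance
definition, made a local instance where needed (it would clash with the `k`-algebra structure if `K` were specialised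
to `↥k`). [cite: Milne2007FundamentalCM, §4.2 Prop. 4.9 (proof: «L_j = (σ_j⁻¹E*)E», «b_j = Nm_{L_j/E}(σ_j⁻¹(a))»)]
[cite: MilneCM2006, Ch. I §1 Prop. 1.21 (proof: «k_φ … on which e ∈ E acts as φ(e)»)] -/
abbrev orbitFieldAlgebra (φ : Emb K) : Algebra K (orbitField k φ) :=
  ((toOrbitField k φ : K →ₐ[ℚ] orbitField k φ) : K →+* orbitField k φ).toAlgebra

attribute [local instance] orbitFieldAlgebra

/-- Unfolding: `algebraMap K (k·φ(K)) a = φ(a)`. [cite: MilneCM2006, Ch. I §1 Prop. 1.21 (proof)] -/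
theorem algebraMap_orbitField_apply (φ : Emb K) (a : K) :
    algebraMap K (orbitField k φ) a = toOrbitField k φ a := rfl

/-- In `ℂ`: `algebraMap K (k·φ(K)) a = φ a`. [cite: MilneCM2006, Ch. I §1 Prop. 1.21 (proof)] -/
theorem coe_algebraMap_orbitField (φ : Emb K) (a : K) :
    ((algebraMap K (orbitField k φ) a : orbitField k φ) : ℂ) = φ a := rfl

/-- `ℚ → K → k·φ(K)` is a scalar tower. [cite: MilneCM2006, Ch. I §1 Prop. 1.21 (proof)] -/
theorem isScalarTower_orbitField (φ : Emb K) : IsScalarTower ℚ K (orbitField k φ) :=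
  IsScalarTower.of_algebraMap_eq fun q => ((toOrbitField k φ).commutes q).symm

attribute [local instance] isScalarTower_orbitField

/-- The inclusion `ι : k → k·φ(K)` as a `ℚ`-algebra homomorphism (Milne's `E* ⊆ σ_jL_j`; on adèles it induces the conorm
`con_{M/k}`, «`σ_j⁻¹(a)`» read in `σ_jL_j`). [cite: Milne2007FundamentalCM, §4.2 Prop. 4.9 (proof)] -/
abbrev toOrbitFieldBase (φ : Emb K) : k →ₐ[ℚ] orbitField k φ := IsScalarTower.toAlgHom ℚ k (orbitField k φ)

/-- Unfolding. [cite: Milne2007FundamentalCM, §4.2 Prop. 4.9 (proof)] -/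
theorem toOrbitFieldBase_apply (φ : Emb K) (a : k) : toOrbitFieldBase K k φ a = algebraMap k (orbitField k φ) a := rfl

/-- Plumbing: `(1 ⊗ ι) ∘ (φ ⊗ 1) = (φ ⊗ 1) ∘ (1 ⊗ ι)` on `R ⊗ k` («functorial in `R`»). [cite: MilneCM2006, Ch. I §1 (p. 16, «functorial in R»)] -/
theorem map_id_map_comm {R R' : Type} [CommRing R] [Algebra ℚ R] [CommRing R'] [Algebra ℚ R']
    {M : Type} [CommRing M] [Algebra ℚ M] (ψ : R →ₐ[ℚ] R') (ι : k →ₐ[ℚ] M) (x : R ⊗[ℚ] k) :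
    Algebra.TensorProduct.map (AlgHom.id R' R') ι (Algebra.TensorProduct.map ψ (AlgHom.id ℚ k) x) =
      Algebra.TensorProduct.map ψ (AlgHom.id ℚ M) (Algebra.TensorProduct.map (AlgHom.id R R) ι x) := by
  induction x using TensorProduct.induction_on with
  | zero => simp only [map_zero]
  | tmul r a => simp only [Algebra.TensorProduct.map_tmul, AlgHom.id_apply]
  | add x y hx hy => simp only [map_add, hx, hy]

variable [NumberField k]

/-- `k·φ(K)` is finite over `K` (it is finite over `ℚ`). [cite: MilneCM2006, Ch. I §1 Prop. 1.21 (proof)] -/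
theorem moduleFinite_orbitField (φ : Emb K) : Module.Finite K (orbitField k φ) := by
  haveI : Module.Finite ℚ (orbitField k φ) := Module.Finite.trans k (orbitField k φ)
  exact Module.Finite.of_restrictScalars_finite ℚ K (orbitField k φ)

/-- `k·φ(K)` is a number field. [cite: MilneCM2006, Ch. I §1 Prop. 1.21 (proof)] -/
theorem numberField_orbitField (φ : Emb K) : NumberField (orbitField k φ) :=
  NumberField.of_module_finite k (orbitField k φ)

attribute [local instance] moduleFinite_orbitField numberField_orbitField

end OrbitFieldAlgebra

attribute [local instance] orbitFieldAlgebra isScalarTower_orbitField moduleFinite_orbitField numberField_orbitField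

/-! ## §1 «`N_Φ(a) = ∏ b_j`» on `R`-points: `N_{k,Φ}(R) = ∏_r Nm_{M_r/K}(R) ∘ (1 ⊗ ι_r)` -/

section Points

variable (K : Type) [Field K] [NumberField K] (Φ : CMType K) (k : IntermediateField ℚ ℂ) [NumberField k]

/-- **«`N_Φ(a) = ∏_j Nm_{L_j/E}(σ_j⁻¹(a))`» ON `R`-POINTS.**  For `k ⊇ E*`, every commutative `ℚ`-algebra `R` and
`x ∈ R ⊗_ℚ k`: `N_{k,Φ}(R)(x) = ∏_r Nm_{M_r⊗R/K⊗R}((1 ⊗ ι_r) x)` over the `Aut(ℂ/k)`-orbit representatives `r ∈ Φ`, with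
`M_r = k·r(K)` a `K`-algebra through `r` — an identity of homomorphisms of tori `T^k → T^E` on points.  PROOF: both sides
are natural in `R`; at `R = ℚ` it is `N_{k,Φ}(a) = ∏_r Nm_{k·r(K)/K}(a)` (`reflexNormFrom_eq_prod_norm_orbitField`, the
determinant of `a` on `V_Φ = ⊕_O k·φ_O(K)` block by block); the density lemma `pointsMap_eq_of_natural_of_eq_base'`
concludes. [cite: Milne2007FundamentalCM, §4.2 Prop. 4.9 (proof: «Thus N_Φ(a) = ∏ b_j, with b_j = Nm_{L_j/E}(σ_j⁻¹(a))»)]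
[cite: MilneCM2006, Ch. I §1 Prop. 1.26 and Rem. 1.25] -/
theorem reflexNormPoints_eq_prod_normPoints_orbitField (R : Type) [CommRing R] [Algebra ℚ R]
    (x : R ⊗[ℚ] k) :
    reflexNormPoints K Φ k R x = ∏ r : ↥(orbitReps (cmTypeEquivCMTypeOn K Φ) k),
      normPoints K (orbitField k (r : Emb K)) R
        (Algebra.TensorProduct.map (AlgHom.id R R) (toOrbitFieldBase K k (r : Emb K)) x) := by
  refine pointsMap_eq_of_natural_of_eq_base' (F₀ := ℚ) (k := k) (K := K)
    (fun R _ _ x => reflexNormPoints K Φ k R x)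
    (fun R _ _ x => ∏ r : ↥(orbitReps (cmTypeEquivCMTypeOn K Φ) k),
      normPoints K (orbitField k (r : Emb K)) R
        (Algebra.TensorProduct.map (AlgHom.id R R) (toOrbitFieldBase K k (r : Emb K)) x))
    (fun R S _ _ _ _ ψ x => reflexNormPoints_map K Φ k R ψ x)
    (fun R S _ _ _ _ ψ x => by
      rw [map_prod]
      refine Finset.prod_congr rfl fun r _ => ?_
      rw [← normPoints_map, map_id_map_comm])
    (fun a => by
      rw [reflexNormPoints_one_tmul, reflexNormFrom_eq_prod_norm_orbitField K Φ k a]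
      have h : ∀ r : ↥(orbitReps (cmTypeEquivCMTypeOn K Φ) k),
          normPoints K (orbitField k (r : Emb K)) ℚ
              (Algebra.TensorProduct.map (AlgHom.id ℚ ℚ) (toOrbitFieldBase K k (r : Emb K)) ((1 : ℚ) ⊗ₜ[ℚ] a)) =
            Algebra.TensorProduct.includeRight (R := ℚ) (A := ℚ) (B := K)
              (Algebra.norm K (algebraMap k (orbitField k (r : Emb K)) a)) := fun r => by
        rw [Algebra.TensorProduct.map_tmul, AlgHom.id_apply, toOrbitFieldBase_apply, normPoints_one_tmul,
          Algebra.TensorProduct.includeRight_apply]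
      simp_rw [h, ← map_prod, Algebra.TensorProduct.includeRight_apply])
    R x

/-- The same as an identity of monoid homomorphisms `R ⊗ k → R ⊗ K`.
[cite: Milne2007FundamentalCM, §4.2 Prop. 4.9 (proof)] [cite: MilneCM2006, Ch. I §1 Rem. 1.25] -/
theorem reflexNormPoints_eq_prod_comp (R : Type) [CommRing R] [Algebra ℚ R] :
    reflexNormPoints K Φ k R = ∏ r : ↥(orbitReps (cmTypeEquivCMTypeOn K Φ) k),
      (normPoints K (orbitField k (r : Emb K)) R).comp
        (Algebra.TensorProduct.map (AlgHom.id R R) (toOrbitFieldBase K k (r : Emb K))).toMonoidHom := by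
  refine MonoidHom.ext fun x => ?_
  rw [reflexNormPoints_eq_prod_normPoints_orbitField K Φ k R x, MonoidHom.finsetProd_apply]
  rfl

end Points

/-! ## §2 «`N_Φ(a) = ∏ b_j`» on adèles: `N_{k,Φ}(x) = ∏_r Nm_{M_r/K}(con_{M_r/k} x)` -/

section Adele

variable (K : Type) [Field K] [NumberField K] (Φ : CMType K) (k : IntermediateField ℚ ℂ) [NumberField k]

/-- **The identification `𝔸_ℚ ⊗_ℚ M = 𝔸_M` intertwines `1 ⊗ ι` with the conorm**: `e_M((1 ⊗ ι) z) = con_{M/k}(e_k z)`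
for `z ∈ 𝔸_ℚ ⊗_ℚ k` (the packet's `algebraMap_comp_adeleRingTensorAlgEquiv` at `ℚ ⊆ k ⊆ M`, read for the tree's
`ratAdeleTensorEquiv`). [cite: CasselsFrohlichANT1967, Ch. II §19 (19.1)–(19.3)] -/
theorem ratAdeleTensorEquiv_map_toOrbitFieldBase (φ : Emb K) (z : (AdeleRing (𝓞 ℚ) ℚ) ⊗[ℚ] k) :
    ratAdeleTensorEquiv (orbitField k φ)
        (Algebra.TensorProduct.map (AlgHom.id (AdeleRing (𝓞 ℚ) ℚ) (AdeleRing (𝓞 ℚ) ℚ)) (toOrbitFieldBase K k φ) z) =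
      NumberField.AdeleRing.baseChange k (orbitField k φ) (ratAdeleTensorEquiv k z) := by
  letI := tensorTowerAlgebra ℚ k (orbitField k φ)
  -- `ratAdeleTensorEquiv M = adeleRingTensorAlgEquiv ℚ M` on elements and `algebraMap 𝔸_k 𝔸_M = con`, definitionally
  exact (RingHom.congr_fun (algebraMap_comp_adeleRingTensorAlgEquiv ℚ k (orbitField k φ)) z).symm

/-- **«`N_Φ(a) = ∏_j Nm_{L_j/E}(σ_j⁻¹(a))`» ON ADÈLES: `N_{k,Φ}(x) = ∏_r Nm_{M_r/K}(con_{M_r/k} x)` for every `x ∈ 𝔸_k`**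
(`k ⊇ E*`): Shimura's / Milne's idelic reflex norm `reflexNormAdele K Φ k` is the product over the orbit representatives
`r` of the adelic norms `N_{M_r/K}` (Cassels–Fröhlich (19.7), `adeleRelNorm K M_r`, `M_r = k·r(K)` a `K`-algebra through `r`)
of the conorms `con_{M_r/k} x`.  From §1 at `R = 𝔸_ℚ`. [cite: Milne2007FundamentalCM, §4.2 Prop. 4.9 (proof: «N_Φ(a) = ∏ b_j»)]
[cite: MilneCM2006, Ch. I §1 Rem. 1.25 («a continuous homomorphism on the groups of idèles»)] -/
theorem reflexNormAdele_eq_prod_adeleRelNorm_orbitField (x : AdeleRing (𝓞 k) k) :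
    reflexNormAdele K Φ k x = ∏ r : ↥(orbitReps (cmTypeEquivCMTypeOn K Φ) k),
      adeleRelNorm K (orbitField k (r : Emb K))
        (NumberField.AdeleRing.baseChange k (orbitField k (r : Emb K)) x) := by
  rw [reflexNormAdele_apply, reflexNormPoints_eq_prod_normPoints_orbitField K Φ k, map_prod]
  refine Finset.prod_congr rfl fun r _ => ?_
  rw [← adeleRelNorm_ratAdeleTensorEquiv_eq_normPoints, ratAdeleTensorEquiv_map_toOrbitFieldBase,
    RingEquiv.apply_symm_apply]

end Adele

/-! ## §3 «`N_Φ(a) = ∏ b_j`» on idèles and on their finite parts -/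

section Idele

variable (K : Type) [Field K] [NumberField K] (Φ : CMType K) (k : IntermediateField ℚ ℂ) [NumberField k]

/-- **«`N_Φ(a) = ∏_j b_j`, `b_j = Nm_{L_j/E}(σ_j⁻¹(a))`» ON IDÈLES: `N_{k,Φ}(s) = ∏_r Nm_{M_r/K}(con_{M_r/k} s)` for every
`s ∈ 𝕀_k`** (`k ⊇ E*`), with the continuous homomorphisms `reflexNormIdele K Φ k : 𝕀_k → 𝕀_K` (`…/ReflexNormIdeles`),
`ideleRelNorm K M_r : 𝕀_{M_r} → 𝕀_K` and the conorm `Units.map (AdeleRing.baseChange k M_r) : 𝕀_k → 𝕀_{M_r}`.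
[cite: Milne2007FundamentalCM, §4.2 Prop. 4.9 (proof: «Thus N_Φ(a) = ∏ b_j, with b_j = Nm_{L_j/E}(σ_j⁻¹(a))»)]
[cite: MilneCM2006, Ch. I §1 Rem. 1.25] -/
theorem reflexNormIdele_eq_prod_ideleRelNorm_orbitField (s : ideleGroup k) :
    reflexNormIdele K Φ k s = ∏ r : ↥(orbitReps (cmTypeEquivCMTypeOn K Φ) k),
      ideleRelNorm K (orbitField k (r : Emb K))
        (Units.map (NumberField.AdeleRing.baseChange k (orbitField k (r : Emb K)) :
          AdeleRing (𝓞 k) k →* AdeleRing (𝓞 (orbitField k (r : Emb K))) (orbitField k (r : Emb K))) s) := by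
  refine Units.ext ?_
  rw [coe_reflexNormIdele, reflexNormAdele_eq_prod_adeleRelNorm_orbitField K Φ k, Units.coe_prod]
  exact Finset.prod_congr rfl fun r _ => rfl

/-- **On finite parts**: `N_{k,Φ}(s)_𝐡 = ∏_r (Nm_{M_r/K}(con_{M_r/k} s))_𝐡` — the finite idèle `N_Φ(a) = ∏ b_j` of Milne's
proof (`b_j ∈ 𝔸^×_{f,E}`). [cite: Milne2007FundamentalCM, §4.2 Prop. 4.9 (proof: «N_Φ(a) = ∏ b_j»)] -/
theorem finitePart_reflexNormIdele_eq_prod (s : ideleGroup k) :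
    IdeleAction.finitePart K (reflexNormIdele K Φ k s) = ∏ r : ↥(orbitReps (cmTypeEquivCMTypeOn K Φ) k),
      IdeleAction.finitePart K (ideleRelNorm K (orbitField k (r : Emb K))
        (Units.map (NumberField.AdeleRing.baseChange k (orbitField k (r : Emb K)) :
          AdeleRing (𝓞 k) k →* AdeleRing (𝓞 (orbitField k (r : Emb K))) (orbitField k (r : Emb K))) s)) := by
  rw [reflexNormIdele_eq_prod_ideleRelNorm_orbitField K Φ k s, map_prod]

end Idele

end Literature.NumberTheory.ComplexMultiplication

end
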